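import Summits.Schanuel.Schanuel.Theorems.KhovanskiiApproxType.Negative.LoadBearing
import Summits.Schanuel.Schanuel.Theorems.KhovanskiiApproxType.Negative.NonUniform
import Summits.Schanuel.Schanuel.Theorems.DiophantineDichotomyKhovanskiiApproxTypeEvDefs
import Summits.Schanuel.Schanuel.Theorems.EPiSimultaneousType.Negative.CoordinatewiseLinear
import Literature.NumberTheory.Transcendental.LindemannWeierstrassProofs

/-!
# Disproof of `KhovanskiiApproxTypeEv` (stmt-Schanuel-14972) — findings (cdisprove cycle 1,
# refuter-cdisprove-stmt-Schanuel-14972-0, 2026-08-16)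

Crux (route `DiophantineDichotomy`): *for `n ≥ 2` and every free Khovanskii point `θ = (s, e^s) ∈ ℂ²ⁿ`
with `ℚ`-linearly independent `s`, `∃ a < 1/(n−1), b, C > 0` such that for every degree budget `d`
there is a threshold `H₀(d)` with `‖γ − θ‖ ≥ exp(−C(dᵃ log H + dᵇ))` for all `H ≥ H₀(d)` and all
algebraic challengers `γ` of level `(d, H)`* — pointwise `∃ a b C, a < 1/(n−1) ∧ ApproxTypeEvAt n s a b C`
(`khovanskiiApproxTypeEv_iff`, `Iff.rfl`, vocabulary of the line lead's accepted
`Theorems/DiophantineDichotomyKhovanskiiApproxTypeEvDefs.lean`, namespace `…AnchoredReduction`).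
INPUTS READ: route file; `Cruxes/KhovanskiiApproxType/Disproof.lean` (6116 cycle 1 FINAL: engine
`not_approxTypeAt_const_one`, `_false_without_{twoLe,linIndep,khovanskii}`, `_from_one`,
`not_khovanskiiApproxTypeUniform`, `slotFloor_false_of_lt_one`); landed `Theorems/KhovanskiiApproxType/Negative/*`;
`Theorems/EPiSimultaneousTypeEv/Negative/CoordinatewiseLinear.lean` (a ≥ 1/2 at (π, e) MODULO `hB`);
one-shot refuter evidence CRUX-ATTACK-14972.md / W.lean (corners neutral, `ev_iff_noB`); line `Sketch`
(anchored-reduction, 7 stubs) and `PICKED.md`.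

## Verdict (cycle 1): NO KILL — why it resists
A kill needs ONE free Khovanskii point `θ` (isolated zero of a `ℚ`-Khovanskii system — a countable set of
explicit classical-constant-like points: `e^{alg}`, `log alg`, `π`-, `Ω`-type, mixed) with
`limsup_d w_d^{sim}(θ)/dᵃ = ∞` for every `a < 1/(n−1)`, where `w_d^{sim}` is the exponent of
simultaneous approximation of ALL `2n` coordinates inside ONE number field of degree `≤ d` with unbounded
height.  Generic value `w_d^{sim} ≍ d^{1/trdeg θ} = d^{1/n}` (inside the window); `≥ d^{1/(n−1)}` is
forced only by `trdeg θ ≤ n − 1` (a Schanuel counterexample — the route's own race, AP(1) known, so at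
`n = 2` the crux CONTAINS `e ⊥ π`, `log 2 ⊥ log 3` with measures); abnormal approximability of a natural
constant tuple is unprovable with anything in print or in tree.  Computation cannot bite (eventual +
ineffective `H₀(d)` + existential `a, b, C`).  The formal statement is faithful (all junk corners
neutral; re-confirmed).  So the deliverables of this cycle are KERNEL-CHECKED NEGATIVE LEMMAS around it.

## Findings, indexed (prose only in docstrings; everything below is sorry-free unless in §(e))
(a) LOAD-BEARING HYPOTHESES, eventual form — LANDED (p99066 ACCEPTED, commit 6d597943b774) as
    `Theorems/KhovanskiiApproxTypeEv/Negative/LoadBearing.lean` (`--supports stmt-Schanuel-14972`):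
    * `not_approxTypeEvAt_const_one` — THE ENGINE transported: Diaz (Bugeaud 2004 Thm 8.11, PROVED in
      tree) beats every `a < 1` along one transcendental slot PAST ANY THRESHOLD `H₀(d)` (the threshold
      is absorbed into the `M`-free slack: `H := max (max H₀ 1) H(minpoly α)`).
    * `khovanskiiApproxTypeEv_false_without_twoLe` (`n = 0`, empty challenger), `_false_from_one`
      (`1 ≤ n`: HL point `s = (1)`, typed bound `a < 1/0 = 0`), `_false_without_linIndep`
      (`s = (1, 1)`, `θ = (1, 1, e, e)`): ANY PROOF must use `2 ≤ n` and linear independence, the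
      latter to produce two independent transcendental directions.
    * NOT transported — and the one-shot refuter's note ("Diaz/ultra-Liouville witnesses live at every
      large scale, so they transfer to the eventual variants") is WRONG for this one:
      `khovanskiiApproxType_false_without_khovanskii` (6116: ultra-Liouville tower `s = (log 2, r log 2)`)
      does NOT refute the eventual variant.  At tower stage `k` the budget `d_k = n_k q_k` is fixed and
      every stage-`k` challenger is at distance `≥ |r − r_k| log 2 > 0` from `θ`; a point-dependent
      threshold `H₀(d_k) > exp(t_{k+1} log 10 /(C d_kᵃ))` outruns the stage, and stage-`k` challengers
      re-used at a later budget `d_j` lose to the `d_jᵇ` term (`d_j ≥ 10^{t_{k+1}}`).  See §(e).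
(b) TIGHTNESS — LANDED (p99459 ACCEPTED, commit 852a466105f7) as `…/Negative/NonUniform.lean`: `not_khovanskiiApproxTypeEvUniform` — even
    eventually, `(a, b, C)` TOGETHER WITH the thresholds `H₀(d)` cannot be uniform in the point
    (Lambert family `s_k = (x_k, √2 x_k) → 0` of 6116's NonUniform, challenger `(0,0,1,1)` at level
    `(1, H)` for every `H`).  With point-dependent thresholds the family proves nothing: the eventual
    form can trade a blown-up constant for a blown-up threshold (recorded, not refuted).
(c) NATURAL STRENGTHENINGS REFUTED — LANDED `…/Negative/ConjugateFloor.lean` (LW point, p100002 ACCEPTED,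
    commit 353ef77a6b7e) and PROPOSED `…/Negative/ConjugateFloorLog.lean` (log point, p100647):
    **the floor `a ≥ 1/2` at `n = 2`, kernel-checked WITHOUT Philippon's approximation property, on
    BOTH layers** (the route text had it "printed, not formalised, needs AP(2)").  LW layer: at
    `s = (1 + i, 1 − i)` the transcendental slots are `ξ = e^{1+i}` and `ξ̄`; non-LW layer: at
    `s = (λ, λ̄)`, `λ = log(2i) = log 2 + iπ/2` (transcendental by Hermite–Lindemann, PROVED in tree),
    the slots are `λ, λ̄` and `e^{s} = (2i, −2i)` is algebraic.  In both cases the Diaz approximant `α`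
    of the slot and its complex conjugate `ᾱ` are roots of the SAME integer polynomial (same height)
    with `|ξ̄ − ᾱ| = |ξ − α|`, so `(…, α, ᾱ, …) ∈ ℚ(i, α, ᾱ)` (degree `≤ 2n²`) has quality
    `0.006·n·log M(α)`, linear in `n ≍ d^{1/2}`: `not_approxTypeEvAt_conjPair`,
    `not_approxTypeEvAt_conjLogPair` (no `(a,b,C)` with `a < 1/2`), hence
    `khovanskiiApproxTypeEv_false_sharp` (the crux with `a < 1/n` is FALSE), `khovanskiiApproxType_false_sharp`
    (so is 6116 with `a < 1/n`), `evLWTwo_window` / `evNonLWTwo_window` (the line's layers `EvLWTwo`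
    — value `3/4` from Ably 1994 through the transfer spine — and `EvNonLWTwo` both live in `[1/2, 1)`).
    LIMIT OF THE TRICK: conjugation is the only continuous field automorphism, so one approximant serves
    at most the pair `{ξ, ξ̄}`; two independent Diaz approximants in one challenger cannot be
    height-synchronised (Bugeaud 8.11's quality is relative to `M(α)`, bounded only from above; forcing
    `M(α) ≥ M^κ` through a transcendence measure of type `w(n)` costs exactly the factor `n/w(n)`) — the
    wall the 14975 seat met (`hB`).  GALOIS conjugates do not help either: Roy–Waldschmidt 2004
    (Compositio 140, arXiv math/0207102, READ) Prop. 10.1 caps `t ≥ 2` conjugates of one `α` near ONE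
    point at exponent `2n/(t(t−1))`, and Prop. 10.2 builds, for each `n`, `t` reals with no algebraic
    `t`-tuple of degree `≤ n`, height `≤ H` closer than `H^{−3n^{1/t}}` — complex conjugation (an
    isometry) is what makes the pair `{ξ, ξ̄}` free.  Hence no unconditional floor at `n ≥ 3` here.
(d) TARGETS — payload.targets = [] (lead at cycle 0).  LINE AUDIT (`Lines/Sketch.lean`, anchored-reduction):
    joint sufficiency `KhovanskiiApproxTypeEv_of` is an honest case split (LW n=2 ∨ non-LW n=2 ∨ n≥3),
    nothing smuggled; `stub_unanchoring : SchanuelAnchored → Schanuel` checked TRUE on paper in all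
    cases `k = dim(span s ∩ span(1, iπ)) ∈ {0,1,2}` (incl. `span ∋ p + q iπ`, `q ≠ 0 ⇒ iπ ∈ ℚ(s)` and
    `e^p` algebraic over `ℚ(e^s)`); `stub_raceAnchored` = `closes` verbatim; `stub_evLW_two_of_ably`
    consistent with (c) (`3/4 ≥ 1/2`); `stub_evNonLW_two` ⊇ `EPiSimultaneousTypeEv` (e ⊥ π strength),
    `stub_evRankThreeUp` = crux for `n ≥ 3` — open-problem grade, not cheaply attackable.  No stub is
    false or misstated as far as cheap attacks reach.
(e) NEAR-MISSES (sorried, this file only): `khovanskiiApproxTypeEv_false_without_khovanskii` — OPEN: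
    needs a `ℚ`-lin. independent `s` (no system) with `θ` simultaneously Liouville AT BOUNDED DEGREE,
    i.e. infinitely many points of one number field abnormally close to the graph of `exp`; every
    construction tried hits either Schanuel-known independence (one transcendental direction ⇒ trdeg 1
    ⇒ LW/HL contradiction or an open case) or the height-synchronisation wall (two Diaz slots ⇒ only
    `a < 1/2`); Baire/measure arguments would need an EXISTENCE theorem for algebraic points of bounded
    degree within `H^{−ω(d)}`, `ω(d)/dᵃ → ∞`, of the graph of `exp` (heuristically true with `ω ≍ d`,
    unproved).  `floor_third_at_lw_three` — the floor `a ≥ 1/3` at an LW 3-point (needs AP(3) or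
    synchronised Wirsing).  Both carry their obstruction in the docstring.

PROVERS, in one line each: (i) thresholds do not weaken what linear independence / `n ≥ 2` must do;
(ii) at `n = 2` the target window is exactly `[1/2, 1)` — any architecture capped below `1/2` is wrong,
any claim of `a < 1/2` is false; (iii) in the eventual form non-degeneracy may enter through `H₀(d, θ)`
rather than `C(θ)` — the 6116 moral "use non-degeneracy quantitatively in `C`" is not forced here.
-/

noncomputable section

set_option linter.dupNamespace false

namespace Summit.Schanuel.Schanuel.Cruxes.KhovanskiiApproxTypeEv.Disproof

open Summit.Schanuel.Schanuel.Theses.DiophantineDichotomy (KhovanskiiApproxTypeEv KhovanskiiApproxType)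
open Summit.Schanuel.Schanuel.Cruxes.KhovanskiiApproxType.LwSmallHeight
open Summit.Schanuel.Schanuel.Cruxes.KhovanskiiApproxType.Negative
open Summit.Schanuel.Schanuel.Cruxes.KhovanskiiApproxTypeEv.AnchoredReduction
  (ApproxTypeEvAt khovanskiiApproxTypeEv_iff EvLWTwo EvNonLWTwo)
open Summit.Schanuel.Schanuel.Theorems.EPiSimultaneousType (finrank_adjoin_simple_le_of_clause)
open Polynomial Complex
open scoped IntermediateField ComplexConjugate
open Literature.NumberTheory.DiophantineApproximation (Bugeaud2004_thm_8_11_holds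
  one_le_mahlerMeasure_map)

/-! # (a) Load-bearing hypotheses (copy of the proposed `Negative/LoadBearing.lean`) -/

/-- The all-heights type implies the eventual one (threshold `H₀ := 0`). -/
theorem approxTypeEvAt_of_approxTypeAt {n : ℕ} {s : Fin n → ℂ} {a b C : ℝ}
    (h : ApproxTypeAt n s a b C) : ApproxTypeEvAt n s a b C :=
  ⟨h.1, fun d => ⟨0, fun H γ _ hdeg hroot => h.2 d H γ hdeg hroot⟩⟩

/-! ## The engine, eventual version: Diaz beats every `a < 1` along one slot, past any threshold -/

set_option maxHeartbeats 800000 in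
/-- **Diaz's theorem kills every exponent `a < 1` at `θ = (1,…,1, e,…,e) ∈ ℂ²ᵐ`, EVENTUALLY IN THE
HEIGHT.** For `s = (1, …, 1)` and any `a < 1`, `b`, `C > 0` and any threshold `H₀ = H₀(n)` attached
to the budget `d := n` (`n` with `C n^{max a 0} ≤ 0.003 n`), the challengers `γ = (1,…,1, α,…,α)`,
`α` the algebraic approximation of `e` of degree `≤ n`, Mahler measure `≤ M`, from Bugeaud 2004
Thm 8.11 (= Diaz 1997, PROVED in tree), are admissible at level `(n, H)` with
`H := max (max H₀ 1) H(minpoly α) ≥ H₀`, and beat `exp(−C(nᵃ log H + nᵇ))` as soon as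
`log M > (C(n^a(n log 2 + log(max H₀ 1)) + nᵇ))/0.006 + 1`: the quality
`0.006(n log M(α) + deg α · log M)` is linear in `n` and `M` is free at fixed `n`.
[cite: Bugeaud2004, Thm 8.11] -/
theorem not_approxTypeEvAt_const_one (m : ℕ) (a b C : ℝ) (ha : a < 1) :
    ¬ ApproxTypeEvAt m (fun _ => (1 : ℂ)) a b C := by
  rintro ⟨hC, hall⟩
  -- nonnegative exponents dominate
  set a' : ℝ := max a 0 with ha'
  set b' : ℝ := max b 0 with hb'
  have ha'1 : a' < 1 := max_lt ha one_pos
  obtain ⟨n, hn50, hn⟩ := exists_deg a' C ha'1 hC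
  have hn1nat : 1 ≤ n := le_trans (by norm_num) hn50
  have hn1 : (1 : ℝ) ≤ n := by exact_mod_cast hn1nat
  have hnpos : (0 : ℝ) < n := by linarith
  -- the threshold of the eventual form at budget `n`
  obtain ⟨H₀, hH₀⟩ := hall n
  set H₁ : ℕ := max H₀ 1 with hH₁def
  have hH₁1nat : 1 ≤ H₁ := le_max_right _ _
  have hH₁1 : (1 : ℝ) ≤ H₁ := by exact_mod_cast hH₁1nat
  have hH₁pos : (0 : ℝ) < H₁ := by linarith
  have hlogH₁ : 0 ≤ Real.log H₁ := Real.log_nonneg hH₁1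
  -- the M-independent slack (threshold included) and the choice of M
  set K0 : ℝ := C * ((n : ℝ) ^ a' * (n * Real.log 2 + Real.log H₁) + (n : ℝ) ^ b') with hK0
  set ξ : ℂ := Complex.exp 1 with hξ
  set M : ℝ := max (max ((n : ℝ) + 1) ((4 + ‖ξ‖) ^ 100)) (Real.exp (K0 / (6 / 1000) + 1))
    with hMdef
  have hM1 : (n : ℝ) + 1 ≤ M := (le_max_left _ _).trans (le_max_left _ _)
  have hM2 : (4 + ‖ξ‖) ^ 100 ≤ M := (le_max_right _ _).trans (le_max_left _ _)
  have hMpos : 0 < M := by linarith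
  have hlogM : K0 / (6 / 1000) + 1 ≤ Real.log M := by
    rw [Real.le_log_iff_exp_le hMpos]
    exact le_max_right _ _
  -- Diaz / Bugeaud 8.11 at ξ = e
  obtain ⟨α, P, hPirr, hPα, hPdeg, hPM, hdist⟩ := Bugeaud2004_thm_8_11_holds ξ n M hn50 hM1 hM2
  have hP0 : P ≠ 0 := hPirr.ne_zero
  have hdP : 1 ≤ P.natDegree := by
    rw [Nat.one_le_iff_ne_zero]
    intro h0
    have hc : P = Polynomial.C (P.coeff 0) := eq_C_of_natDegree_eq_zero h0
    rw [hc, aeval_C, algebraMap_int_eq, eq_intCast, Int.cast_eq_zero] at hPα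
    exact hP0 (by rw [hc, hPα, map_zero])
  set MP : ℝ := (P.map (Int.castRingHom ℂ)).mahlerMeasure with hMP
  have hMP1 : 1 ≤ MP := one_le_mahlerMeasure_map P hP0
  have hlogMP : 0 ≤ Real.log MP := Real.log_nonneg hMP1
  -- the challenger γ = (1, 1, α, α) with budget d := n, H := max H₁ (natHeight P) ≥ H₀
  set H : ℕ := max H₁ (natHeight P) with hHdef
  have hHP : natHeight P ≤ H := le_max_right _ _
  have hH0le : H₀ ≤ H := (le_max_left H₀ 1).trans (le_max_left _ _)
  have hH1 : 1 ≤ H := hH₁1nat.trans (le_max_left _ _)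
  have hH1r : (1 : ℝ) ≤ H := by exact_mod_cast hH1
  have hHpos : (0 : ℝ) < H := by linarith
  set γ : Fin m ⊕ Fin m → ℂ := Sum.elim (fun _ => (1 : ℂ)) (fun _ => α) with hγ
  have hαint : IsIntegral ℚ α := by
    refine (show IsAlgebraic ℚ α from ⟨P.map (Int.castRingHom ℚ), ?_, ?_⟩).isIntegral
    · exact (Polynomial.map_ne_zero_iff (Int.castRingHom ℚ).injective_int).mpr hP0
    · rw [← algebraMap_int_eq, aeval_map_algebraMap]; exact hPα
  have hfr : Module.finrank ℚ ↥(IntermediateField.adjoin ℚ (Set.range γ)) ≤ n := by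
    have hle : IntermediateField.adjoin ℚ (Set.range γ) ≤ IntermediateField.adjoin ℚ {α} := by
      rw [IntermediateField.adjoin_le_iff]
      rintro _ ⟨i, rfl⟩
      rcases i with i | i
      · have : γ (Sum.inl i) = 1 := by simp [hγ]
        rw [this]; exact one_mem _
      · have : γ (Sum.inr i) = α := by simp [hγ]
        rw [this]; exact IntermediateField.mem_adjoin_simple_self ℚ α
    haveI : FiniteDimensional ℚ (IntermediateField.adjoin ℚ {α}) :=
      IntermediateField.adjoin.finiteDimensional hαint
    refine (IntermediateField.finrank_le_of_le_right hle).trans ?_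
    rw [IntermediateField.adjoin.finrank hαint]
    refine le_trans ?_ hPdeg
    have h := minpoly.degree_le_of_ne_zero ℚ α
      ((Polynomial.map_ne_zero_iff (Int.castRingHom ℚ).injective_int).mpr hP0)
      (by rw [← algebraMap_int_eq, aeval_map_algebraMap]; exact hPα)
    have h' := natDegree_le_natDegree h
    rwa [natDegree_map_eq_of_injective (Int.castRingHom ℚ).injective_int] at h'
  have hcl : ∀ i, ∃ Q : Polynomial ℤ, Q ≠ 0 ∧ Q.natDegree ≤ n ∧ (∀ k, |Q.coeff k| ≤ (H : ℤ)) ∧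
      Polynomial.aeval (γ i) Q = 0 := by
    rintro (i | i)
    · refine ⟨X - Polynomial.C 1, X_sub_C_ne_zero 1, ?_, ?_, ?_⟩
      · rw [natDegree_X_sub_C]; exact hn1nat
      · intro k
        have hH1z : (1 : ℤ) ≤ H := by exact_mod_cast hH1
        rw [coeff_sub, coeff_X, coeff_C]
        split_ifs <;> simp <;> omega
      · have : γ (Sum.inl i) = 1 := by simp [hγ]
        simp [this]
    · refine ⟨P, hP0, hPdeg, fun k => (abs_coeff_le_natHeight P k).trans (by exact_mod_cast hHP), ?_⟩
      have : γ (Sum.inr i) = α := by simp [hγ]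
      rw [this]; exact hPα
  have key := hH₀ H γ hH0le hfr hcl
  -- the distance is |e - α|
  have hdist' : ‖γ - Sum.elim (fun _ : Fin m => (1 : ℂ)) (Complex.exp ∘ fun _ : Fin m => (1 : ℂ))‖ ≤
      ‖ξ - α‖ := by
    refine (pi_norm_le_iff_of_nonneg (norm_nonneg _)).mpr ?_
    rintro (i | i)
    · simp [hγ]
    · simp [hγ, hξ, norm_sub_rev]
  -- height bookkeeping: log H ≤ log H₁ + n log 2 + log M(P)
  have hlogH : Real.log H ≤ Real.log H₁ + n * Real.log 2 + Real.log MP := by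
    have h2n1 : (1 : ℝ) ≤ 2 ^ n * MP := one_le_mul_of_one_le_of_one_le (one_le_pow₀ (by norm_num)) hMP1
    have hHle : (H : ℝ) ≤ (H₁ : ℝ) * (2 ^ n * MP) := by
      have hcast : (H : ℝ) = max (H₁ : ℝ) (natHeight P : ℝ) := by rw [hHdef]; push_cast; rfl
      rw [hcast]
      refine max_le (le_mul_of_one_le_right hH₁pos.le h2n1) ?_
      calc (natHeight P : ℝ) ≤ 2 ^ P.natDegree * MP := natHeight_le P
        _ ≤ 2 ^ n * MP := by gcongr; norm_num
        _ ≤ (H₁ : ℝ) * (2 ^ n * MP) := le_mul_of_one_le_left (by positivity) hH₁1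
    calc Real.log H ≤ Real.log ((H₁ : ℝ) * (2 ^ n * MP)) := Real.log_le_log hHpos hHle
      _ = Real.log H₁ + n * Real.log 2 + Real.log MP := by
        rw [Real.log_mul hH₁pos.ne' (by positivity), Real.log_mul (by positivity) (by positivity),
          Real.log_pow]
        ring
  -- exponent bookkeeping
  have hna : (n : ℝ) ^ a ≤ (n : ℝ) ^ a' := Real.rpow_le_rpow_of_exponent_le hn1 (le_max_left _ _)
  have hnb : (n : ℝ) ^ b ≤ (n : ℝ) ^ b' := Real.rpow_le_rpow_of_exponent_le hn1 (le_max_left _ _)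
  have hlogH0 : 0 ≤ Real.log H := Real.log_nonneg hH1r
  have hna'0 : 0 ≤ (n : ℝ) ^ a' := by positivity
  have hLHS : C * ((n : ℝ) ^ a * Real.log H + (n : ℝ) ^ b) ≤
      3 / 1000 * ((n : ℝ) * Real.log MP) + K0 := by
    have step : C * (n : ℝ) ^ a' * Real.log MP ≤ 3 / 1000 * n * Real.log MP :=
      mul_le_mul_of_nonneg_right hn hlogMP
    calc C * ((n : ℝ) ^ a * Real.log H + (n : ℝ) ^ b)
        ≤ C * ((n : ℝ) ^ a' * Real.log H + (n : ℝ) ^ b') := by gcongr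
      _ ≤ C * ((n : ℝ) ^ a' * (Real.log H₁ + n * Real.log 2 + Real.log MP) + (n : ℝ) ^ b') := by
          gcongr
      _ = C * (n : ℝ) ^ a' * Real.log MP + K0 := by rw [hK0]; ring
      _ ≤ 3 / 1000 * n * Real.log MP + K0 := by linarith
      _ = 3 / 1000 * ((n : ℝ) * Real.log MP) + K0 := by ring
  have hKM : K0 < 6 / 1000 * Real.log M := by
    have h6 : (6 / 1000 : ℝ) * (K0 / (6 / 1000)) = K0 := by field_simp
    have h := mul_le_mul_of_nonneg_left hlogM (by norm_num : (0 : ℝ) ≤ 6 / 1000)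
    rw [mul_add, h6] at h
    linarith
  have hX0 : 0 ≤ (n : ℝ) * Real.log MP := by positivity
  have hlM : 0 ≤ Real.log M := by
    have hK0nn : 0 ≤ K0 := by rw [hK0]; positivity
    linarith
  have hY : Real.log M ≤ (P.natDegree : ℝ) * Real.log M :=
    le_mul_of_one_le_left hlM (by exact_mod_cast hdP)
  have hgap : C * ((n : ℝ) ^ a * Real.log H + (n : ℝ) ^ b) <
      6 / 1000 * ((n : ℝ) * Real.log MP + (P.natDegree : ℝ) * Real.log M) := by
    linarith
  -- contradiction
  have hchain : Real.exp (-(C * ((n : ℝ) ^ a * Real.log H + (n : ℝ) ^ b))) ≤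
      Real.exp (-(6 / 1000 * ((n : ℝ) * Real.log MP + (P.natDegree : ℝ) * Real.log M))) :=
    key.trans (hdist'.trans hdist)
  rw [Real.exp_le_exp] at hchain
  linarith

/-! ## (a) Load-bearing hypotheses of the eventual crux -/

/-- The eventual crux with `2 ≤ n` DROPPED. -/
def KhovanskiiApproxTypeEvWithoutTwoLe : Prop :=
  ∀ (n : ℕ) (s : Fin n → ℂ), LinearIndependent ℚ s →
    IsFreeKhovanskii n s → ∃ a b C : ℝ, a < 1 / ((n : ℝ) - 1) ∧ ApproxTypeEvAt n s a b C

/-- The eventual crux with `2 ≤ n` WEAKENED to `1 ≤ n`. -/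
def KhovanskiiApproxTypeEvFromOne : Prop :=
  ∀ (n : ℕ) (s : Fin n → ℂ), 1 ≤ n → LinearIndependent ℚ s →
    IsFreeKhovanskii n s → ∃ a b C : ℝ, a < 1 / ((n : ℝ) - 1) ∧ ApproxTypeEvAt n s a b C

/-- The eventual crux with `LinearIndependent ℚ s` DROPPED. -/
def KhovanskiiApproxTypeEvWithoutLinIndep : Prop :=
  ∀ (n : ℕ) (s : Fin n → ℂ), 2 ≤ n →
    IsFreeKhovanskii n s → ∃ a b C : ℝ, a < 1 / ((n : ℝ) - 1) ∧ ApproxTypeEvAt n s a b C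

/-- Sanity: each variant is implied by the corresponding all-heights variant of 6116 (so the
eventual refutations below are the stronger statements). -/
theorem withoutLinIndep_of_typed (h : KhovanskiiApproxTypeWithoutLinIndep) :
    KhovanskiiApproxTypeEvWithoutLinIndep := fun n s hn hK => by
  obtain ⟨a, b, C, ha, hAT⟩ := h n s hn hK
  exact ⟨a, b, C, ha, approxTypeEvAt_of_approxTypeAt hAT⟩

/-- At `n = 0` no eventual approximation type exists: the (unique, empty) challenger `γ = θ = ()`
is admissible with `d = 1` at every height `H ≥ H₀(1)`, `H ≥ 1`, and has distance `0`. [folklore] -/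
theorem not_approxTypeEvAt_zero (s : Fin 0 → ℂ) (a b C : ℝ) : ¬ ApproxTypeEvAt 0 s a b C := by
  rintro ⟨-, h⟩
  obtain ⟨H₀, hH₀⟩ := h 1
  have h1 := hH₀ (max H₀ 1) (fun _ => 0) (le_max_left _ _) ?_ ?_
  · have : ‖(fun _ : Fin 0 ⊕ Fin 0 => (0 : ℂ)) - Sum.elim s (Complex.exp ∘ s)‖ = 0 := by
      rw [norm_eq_zero]; exact Subsingleton.elim _ _
    rw [this] at h1
    exact absurd h1 (not_le.mpr (Real.exp_pos _))
  · have hr : Set.range (fun _ : Fin 0 ⊕ Fin 0 => (0 : ℂ)) = ∅ := Set.range_eq_empty _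
    rw [hr, IntermediateField.adjoin_empty, IntermediateField.finrank_bot]
  · intro i; exact (IsEmpty.false i).elim

/-- **`2 ≤ n` is load-bearing (trivially) in the eventual crux: dropped, it fails at `n = 0`.** -/
theorem khovanskiiApproxTypeEv_false_without_twoLe : ¬ KhovanskiiApproxTypeEvWithoutTwoLe := by
  intro h
  obtain ⟨a, b, C, -, hAT⟩ := h 0 (fun _ => 1) linearIndependent_empty_type
    (isFreeKhovanskii_const_one 0)
  exact not_approxTypeEvAt_zero _ a b C hAT

/-- **`2 ≤ n` cannot be weakened to `1 ≤ n` in the eventual crux:** at the Hermite–Lindemann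
point `s = (1)`, `θ = (1, e)`, the typed bound is `a < 1/((1:ℝ) − 1) = 0 < 1` and Diaz beats every
`a < 1` past any threshold (the informal `n = 1` statement "some `a < 1` eventually" is false too). -/
theorem khovanskiiApproxTypeEv_false_from_one : ¬ KhovanskiiApproxTypeEvFromOne := by
  intro h
  have hli : LinearIndependent ℚ (fun _ : Fin 1 => (1 : ℂ)) := by
    rw [linearIndependent_unique_iff]; exact one_ne_zero
  obtain ⟨a, b, C, ha, hAT⟩ := h 1 (fun _ => 1) le_rfl hli (isFreeKhovanskii_const_one 1)
  have ha1 : a < 1 := by norm_num at ha; linarith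
  exact not_approxTypeEvAt_const_one 1 a b C ha1 hAT

/-- **`LinearIndependent ℚ s` is load-bearing in the eventual crux:** dropped, it fails at `n = 2`,
`s = (1, 1)` (a non-degenerate zero of `z₁ − 1 = z₂ − 1 = 0`), `θ = (1, 1, e, e)`: every `a < 1` is
beaten, past any threshold `H₀(d)`, by the diagonal challengers `(1, 1, α, α)` of Diaz's theorem.
ANY PROOF of the eventual crux must use linear independence to produce two independent
transcendental directions among the coordinates of `θ`. -/
theorem khovanskiiApproxTypeEv_false_without_linIndep :
    ¬ KhovanskiiApproxTypeEvWithoutLinIndep := by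
  intro h
  obtain ⟨a, b, C, ha, hAT⟩ := h 2 (fun _ => 1) le_rfl (isFreeKhovanskii_const_one 2)
  have ha1 : a < 1 := by norm_num at ha; linarith
  exact not_approxTypeEvAt_const_one 2 a b C ha1 hAT

/-! # (b) Tightness (copy of the proposed `Negative/NonUniform.lean`) -/

/-- The eventual crux with constants `(a, b, C)` AND thresholds `H₀(d)` UNIFORM in the point
(natural strengthening). -/
def KhovanskiiApproxTypeEvUniform : Prop :=
  ∀ n : ℕ, 2 ≤ n → ∃ a b C : ℝ, a < 1 / ((n : ℝ) - 1) ∧ 0 < C ∧ ∀ d : ℕ, ∃ H₀ : ℕ,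
    ∀ s : Fin n → ℂ, LinearIndependent ℚ s → IsFreeKhovanskii n s →
    ∀ (H : ℕ) (γ : Fin n ⊕ Fin n → ℂ), H₀ ≤ H →
      Module.finrank ℚ ↥(IntermediateField.adjoin ℚ (Set.range γ)) ≤ d →
      (∀ i, ∃ P : Polynomial ℤ, P ≠ 0 ∧ P.natDegree ≤ d ∧ (∀ k, |P.coeff k| ≤ (H : ℤ)) ∧
        Polynomial.aeval (γ i) P = 0) →
      Real.exp (-(C * ((d : ℝ) ^ a * Real.log H + (d : ℝ) ^ b))) ≤ ‖γ - Sum.elim s (Complex.exp ∘ s)‖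

set_option maxHeartbeats 400000 in
/-- **Even eventually in the height, `(a, b, C; H₀)` cannot be uniform in the point** (tightness):
at `d = 1` and any height `H ≥ max(H₀(1), 1)` the algebraic point `(0, 0, 1, 1)` is an admissible
challenger, at distance `≤ 2√2/k < exp(−C(log H + 1))` from `θ_k = (x_k, √2 x_k, e^{x_k}, e^{√2 x_k})`
for `k > 3 exp(C(log H + 1))`, where `s_k = (x_k, √2 x_k)`, `k x_k e^{x_k} = 1`, is a free Khovanskii
point with `ℚ`-linearly independent coordinates. [folklore] -/
theorem not_khovanskiiApproxTypeEvUniform : ¬ KhovanskiiApproxTypeEvUniform := by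
  intro h
  obtain ⟨a, b, C, -, hC, hall⟩ := h 2 le_rfl
  obtain ⟨H₀, hH₀⟩ := hall 1
  -- the height and the (positive, point-free) bound at level (1, H)
  set H : ℕ := max H₀ 1 with hHdef
  have hH1 : 1 ≤ H := le_max_right _ _
  have hH1r : (1 : ℝ) ≤ H := by exact_mod_cast hH1
  have hlogH : 0 ≤ Real.log H := Real.log_nonneg hH1r
  set B : ℝ := Real.exp (-(C * (Real.log H + 1))) with hBdef
  have hBpos : 0 < B := Real.exp_pos _
  -- the Lambert point
  set k : ℕ := ⌈3 / B⌉₊ + 2 with hkdef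
  have hk1 : 1 ≤ k := by omega
  have hk2 : (2 : ℝ) ≤ k := by exact_mod_cast (show 2 ≤ k by omega)
  have hkpos : (0 : ℝ) < k := by linarith
  have hkB : 3 / B < k := by
    have := Nat.le_ceil (3 / B)
    have h' : (⌈3 / B⌉₊ : ℝ) + 2 = (k : ℝ) := by rw [hkdef]; push_cast; ring
    linarith
  obtain ⟨x, hx0, hxk, hx⟩ := exists_lambert k hk1
  have key := hH₀ _ (linearIndependent_lambert x hx0.ne') (isFreeKhovanskii_lambert k hk1 x hx hx0)
    H (Sum.elim ![0, 0] ![1, 1]) (le_max_left _ _) ?_ ?_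
  · -- distance bound (as in `not_khovanskiiApproxTypeUniform`)
    have hx1 : x ≤ 1 := hxk.trans (by rw [div_le_one hkpos]; linarith)
    have hsx : Real.sqrt 2 * x ≤ Real.sqrt 2 / k := by
      rw [div_eq_mul_one_div]; exact mul_le_mul_of_nonneg_left hxk (Real.sqrt_nonneg _)
    have hs2 : Real.sqrt 2 < 3 / 2 := by
      rw [Real.sqrt_lt' (by norm_num)]; norm_num
    have hs1 : 1 < Real.sqrt 2 := by
      rw [Real.lt_sqrt (by norm_num)]; norm_num
    have hsxpos : 0 < Real.sqrt 2 * x := by positivity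
    have hsx1 : Real.sqrt 2 * x ≤ 1 := by
      calc Real.sqrt 2 * x ≤ Real.sqrt 2 / k := hsx
        _ ≤ Real.sqrt 2 / 2 := by gcongr
        _ ≤ 1 := by linarith
    have hbound : ‖Sum.elim ![(0 : ℂ), 0] ![1, 1] -
        Sum.elim ![(x : ℂ), ((Real.sqrt 2 * x : ℝ) : ℂ)]
          (Complex.exp ∘ ![(x : ℂ), ((Real.sqrt 2 * x : ℝ) : ℂ)])‖ ≤ 2 * (Real.sqrt 2 / k) := by
      refine (pi_norm_le_iff_of_nonneg (by positivity)).mpr ?_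
      have e1 : |Real.exp x - 1| ≤ 2 * |x| := Real.abs_exp_sub_one_le (by rw [abs_of_pos hx0]; exact hx1)
      have e2 : |Real.exp (Real.sqrt 2 * x) - 1| ≤ 2 * |Real.sqrt 2 * x| :=
        Real.abs_exp_sub_one_le (by rw [abs_of_pos hsxpos]; exact hsx1)
      rw [abs_of_pos hx0] at e1
      rw [abs_of_pos hsxpos] at e2
      rintro (i | i) <;> fin_cases i
      · simp only [Pi.sub_apply, Sum.elim_inl]
        simp
        rw [abs_of_pos hx0]
        nlinarith
      · simp only [Pi.sub_apply, Sum.elim_inl]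
        simp
        rw [abs_of_pos (Real.sqrt_pos.mpr (by norm_num : (0:ℝ) < 2)), abs_of_pos hx0]
        have : 0 ≤ Real.sqrt 2 / k := by positivity
        linarith
      · simp only [Pi.sub_apply, Sum.elim_inr, Function.comp]
        simp
        rw [← Complex.ofReal_exp, ← Complex.ofReal_one, ← Complex.ofReal_sub, Complex.norm_real,
          Real.norm_eq_abs, abs_sub_comm]
        nlinarith
      · simp only [Pi.sub_apply, Sum.elim_inr, Function.comp]
        simp
        rw [← Complex.ofReal_mul, ← Complex.ofReal_exp, ← Complex.ofReal_one, ← Complex.ofReal_sub,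
          Complex.norm_real, Real.norm_eq_abs, abs_sub_comm]
        linarith
    have hlhs : Real.exp (-(C * (((1:ℕ) : ℝ) ^ a * Real.log H + ((1:ℕ) : ℝ) ^ b))) = B := by
      rw [hBdef]; simp
    rw [hlhs] at key
    have hfin : 2 * (Real.sqrt 2 / k) < B := by
      have h3k : 3 / (k : ℝ) < B := by
        rw [div_lt_iff₀ hkpos]
        have := (div_lt_iff₀ hBpos).mp hkB
        linarith
      have h22 : 2 * (Real.sqrt 2 / k) < 3 / (k : ℝ) := by
        rw [show 2 * (Real.sqrt 2 / k) = (2 * Real.sqrt 2) / (k : ℝ) by ring]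
        exact div_lt_div_of_pos_right (by linarith) hkpos
      linarith
    linarith [key.trans hbound]
  · -- finrank: adjoin {0,1} = ⊥
    have : IntermediateField.adjoin ℚ (Set.range (Sum.elim ![(0:ℂ), 0] ![1, 1])) = ⊥ := by
      rw [← le_bot_iff, IntermediateField.adjoin_le_iff]
      rintro _ ⟨i, rfl⟩
      rcases i with i | i <;> fin_cases i
      · exact zero_mem _
      · exact zero_mem _
      · exact one_mem _
      · exact one_mem _
    rw [this, IntermediateField.finrank_bot]
  · have hH1z : (1 : ℤ) ≤ H := by exact_mod_cast hH1
    rintro (i | i) <;> fin_cases i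
    · exact ⟨X, X_ne_zero, by simp, fun k => by rw [coeff_X]; split_ifs <;> simp; omega, by simp⟩
    · exact ⟨X, X_ne_zero, by simp, fun k => by rw [coeff_X]; split_ifs <;> simp; omega, by simp⟩
    · refine ⟨X - Polynomial.C 1, X_sub_C_ne_zero 1, by rw [natDegree_X_sub_C], fun k => ?_, by simp⟩
      rw [coeff_sub, coeff_X, coeff_C]; split_ifs <;> simp <;> omega
    · refine ⟨X - Polynomial.C 1, X_sub_C_ne_zero 1, by rw [natDegree_X_sub_C], fun k => ?_, by simp⟩
      rw [coeff_sub, coeff_X, coeff_C]; split_ifs <;> simp <;> omega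

/-! # (c) Natural strengthenings refuted: the floor `a ≥ 1/2` at `n = 2`, LW point (copy of the proposed `Negative/ConjugateFloor.lean`) -/

/-! ## The point `s = (1 + i, 1 − i)` -/

/-- `(1 + i, 1 − i)` is `ℚ`-linearly independent. -/
theorem linearIndependent_conjPair : LinearIndependent ℚ ![(1 : ℂ) + I, 1 - I] := by
  rw [LinearIndependent.pair_iff]
  intro s t hst
  rw [Rat.smul_def, Rat.smul_def] at hst
  have hre := congrArg Complex.re hst
  have him := congrArg Complex.im hst
  simp at hre him
  have hs : (s : ℝ) = 0 := by linarith
  have ht : (t : ℝ) = 0 := by linarith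
  exact ⟨by exact_mod_cast hs, by exact_mod_cast ht⟩

/-- `(1 + i, 1 − i)` is a non-degenerate zero of the Khovanskii system `z₁ + z₂ − 2 = 0`,
`z₁ z₂ − 2 = 0` over `ℚ`: the exponential Jacobian is `[[1, 1], [z₂, z₁]]`, determinant
`z₁ − z₂ = 2i ≠ 0`. (Every `ℚ̄`-point is free Khovanskii; this is the explicit instance used.) -/
theorem isFreeKhovanskii_conjPair : IsFreeKhovanskii 2 ![(1 : ℂ) + I, 1 - I] := by
  classical
  refine ⟨![MvPolynomial.X (Sum.inl 0) + MvPolynomial.X (Sum.inl 1) - MvPolynomial.C 2,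
    MvPolynomial.X (Sum.inl 0) * MvPolynomial.X (Sum.inl 1) - MvPolynomial.C 2], ?_, ?_⟩
  · intro i
    fin_cases i
    · simp; ring
    · simp
      ring_nf
      simp
  · rw [Matrix.det_fin_two]
    simp [Matrix.of_apply, MvPolynomial.pderiv_X, Derivation.leibniz]

/-- `e^{1−i}` is the complex conjugate of `e^{1+i}`. -/
theorem exp_one_sub_I : Complex.exp (1 - I) = conj (Complex.exp (1 + I)) := by
  rw [← Complex.exp_conj]
  congr 1
  simp [map_add, Complex.conj_I, sub_eq_add_neg]

/-- Evaluation of the integer polynomial `X² − 2X + 2` (minimal polynomial of `1 ± i`). -/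
theorem aeval_quad (z : ℂ) :
    Polynomial.aeval z (X ^ 2 - Polynomial.C 2 * X + Polynomial.C 2 : Polynomial ℤ) =
      z ^ 2 - 2 * z + 2 := by
  simp only [map_add, map_sub, map_mul, map_pow, Polynomial.aeval_X, map_ofNat]

/-- The coefficients of `X² − 2X + 2` are bounded by `2` in absolute value. -/
theorem abs_coeff_quad_le (k : ℕ) :
    |(X ^ 2 - Polynomial.C 2 * X + Polynomial.C 2 : Polynomial ℤ).coeff k| ≤ 2 := by
  rcases k with _ | _ | _ | k
  · norm_num [coeff_X, coeff_C, coeff_X_pow]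
  · norm_num [coeff_X, coeff_C, coeff_X_pow]
  · norm_num [coeff_X, coeff_C, coeff_X_pow]
  · have hk : k + 1 + 1 + 1 ≠ 2 := by omega
    simp [coeff_X, coeff_X_pow, hk]

/-- The coefficients of `X² + 1` are bounded by `1` in absolute value. -/
theorem abs_coeff_Xsq_add_one_le (k : ℕ) :
    |(X ^ 2 + 1 : Polynomial ℤ).coeff k| ≤ 1 := by
  rcases k with _ | _ | _ | k
  · simp [coeff_one, coeff_X_pow]
  · simp [coeff_one, coeff_X_pow]
  · simp [coeff_one, coeff_X_pow]
  · have hk : k + 1 + 1 + 1 ≠ 2 := by omega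
    simp [coeff_one, coeff_X_pow, hk]

/-! ## The engine: a conjugate pair of Diaz challengers beats every `a < 1/2` -/

set_option maxHeartbeats 1600000 in
/-- **At `θ = (1+i, 1−i, e^{1+i}, e^{1−i})` there is no eventual approximation type with `a < 1/2`.**
The challengers are `(1+i, 1−i, α, ᾱ)` with `α` the Diaz approximation of `e^{1+i}` of degree `≤ n`
(Bugeaud 2004 Thm 8.11, PROVED in tree), budget `d = 2n²` (common field `ℚ(i, α, ᾱ)`), height
`H = max(H₀(d), 2, H(minpoly α))`; `ᾱ` is a root of the same integer polynomial and
`|e^{1−i} − ᾱ| = |e^{1+i} − α|`, so the quality `0.006(n log M(α) + deg α · log M)`, linear in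
`n ≍ d^{1/2}`, beats `exp(−C(dᵃ log H + dᵇ))` once `C(2n²)ᵃ ≤ 0.003 n` and `log M` is large.
[cite: Bugeaud2004, Thm 8.11] -/
theorem not_approxTypeEvAt_conjPair (a b C : ℝ) (ha : a < 1 / 2) :
    ¬ ApproxTypeEvAt 2 ![(1 : ℂ) + I, 1 - I] a b C := by
  rintro ⟨hC, hall⟩
  -- nonnegative exponents dominate
  set a' : ℝ := max a 0 with ha'
  set b' : ℝ := max b 0 with hb'
  have ha'h : a' < 1 / 2 := max_lt ha (by norm_num)
  have h2a' : 2 * a' < 1 := by linarith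
  obtain ⟨n, hn50, hn⟩ := exists_deg (2 * a') (2 * C) h2a' (by linarith)
  have hn1nat : 1 ≤ n := le_trans (by norm_num) hn50
  have hn1 : (1 : ℝ) ≤ n := by exact_mod_cast hn1nat
  have hnpos : (0 : ℝ) < n := by linarith
  -- the budget d = 2 n² and the bound C d^{a'} ≤ 0.003 n
  set d : ℕ := 2 * n ^ 2 with hddef
  have hdcast : (d : ℝ) = 2 * (n : ℝ) ^ 2 := by rw [hddef]; push_cast; ring
  have hnd : n ≤ d := by rw [hddef]; nlinarith
  have h2d : 2 ≤ d := by rw [hddef]; nlinarith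
  have hd1 : (1 : ℝ) ≤ d := by exact_mod_cast (hn1nat.trans hnd)
  have hda' : C * (d : ℝ) ^ a' ≤ 3 / 1000 * n := by
    have h1 : (d : ℝ) ^ a' = (2 : ℝ) ^ a' * (n : ℝ) ^ (2 * a') := by
      rw [hdcast, Real.mul_rpow (by norm_num) (by positivity)]
      congr 1
      rw [show ((n : ℝ) ^ 2) = (n : ℝ) ^ (2 : ℝ) by norm_cast, ← Real.rpow_mul hnpos.le]
    have h2 : (2 : ℝ) ^ a' ≤ 2 := by
      have := Real.rpow_le_rpow_of_exponent_le (by norm_num : (1 : ℝ) ≤ 2) (by linarith : a' ≤ 1)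
      rwa [Real.rpow_one] at this
    have h3 : 0 ≤ (n : ℝ) ^ (2 * a') := by positivity
    calc C * (d : ℝ) ^ a' = C * ((2 : ℝ) ^ a' * (n : ℝ) ^ (2 * a')) := by rw [h1]
      _ ≤ C * (2 * (n : ℝ) ^ (2 * a')) := by gcongr
      _ = 2 * C * (n : ℝ) ^ (2 * a') := by ring
      _ ≤ 3 / 1000 * n := hn
  -- the threshold of the eventual form at budget d
  obtain ⟨H₀, hH₀⟩ := hall d
  set H₁ : ℕ := max H₀ 2 with hH₁def
  have hH₁2nat : 2 ≤ H₁ := le_max_right _ _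
  have hH₁1 : (1 : ℝ) ≤ H₁ := by exact_mod_cast le_trans (by norm_num) hH₁2nat
  have hH₁pos : (0 : ℝ) < H₁ := by linarith
  have hlogH₁ : 0 ≤ Real.log H₁ := Real.log_nonneg hH₁1
  -- the M-independent slack (threshold included) and the choice of M
  set K0 : ℝ := C * ((d : ℝ) ^ a' * (n * Real.log 2 + Real.log H₁) + (d : ℝ) ^ b') with hK0
  set ξ : ℂ := Complex.exp (1 + I) with hξ
  set M : ℝ := max (max ((n : ℝ) + 1) ((4 + ‖ξ‖) ^ 100)) (Real.exp (K0 / (6 / 1000) + 1))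
    with hMdef
  have hM1 : (n : ℝ) + 1 ≤ M := (le_max_left _ _).trans (le_max_left _ _)
  have hM2 : (4 + ‖ξ‖) ^ 100 ≤ M := (le_max_right _ _).trans (le_max_left _ _)
  have hMpos : 0 < M := by linarith
  have hlogM : K0 / (6 / 1000) + 1 ≤ Real.log M := by
    rw [Real.le_log_iff_exp_le hMpos]
    exact le_max_right _ _
  -- Diaz / Bugeaud 8.11 at ξ = e^{1+i}
  obtain ⟨α, P, hPirr, hPα, hPdeg, hPM, hdist⟩ := Bugeaud2004_thm_8_11_holds ξ n M hn50 hM1 hM2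
  have hP0 : P ≠ 0 := hPirr.ne_zero
  have hdP : 1 ≤ P.natDegree := by
    rw [Nat.one_le_iff_ne_zero]
    intro h0
    have hc : P = Polynomial.C (P.coeff 0) := eq_C_of_natDegree_eq_zero h0
    rw [hc, aeval_C, algebraMap_int_eq, eq_intCast, Int.cast_eq_zero] at hPα
    exact hP0 (by rw [hc, hPα, map_zero])
  set MP : ℝ := (P.map (Int.castRingHom ℂ)).mahlerMeasure with hMP
  have hMP1 : 1 ≤ MP := one_le_mahlerMeasure_map P hP0
  have hlogMP : 0 ≤ Real.log MP := Real.log_nonneg hMP1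
  -- the conjugate root
  have hPα' : Polynomial.aeval (conj α) P = 0 := by
    have h := Polynomial.aeval_algHom_apply ((starRingEnd ℂ).toIntAlgHom) α P
    rw [RingHom.toIntAlgHom_apply] at h
    change Polynomial.aeval (conj α) P = conj (Polynomial.aeval α P) at h
    rw [h, hPα, map_zero]
  -- the challenger γ = (1+i, 1−i, α, conj α), budget d, height H := max H₁ (natHeight P) ≥ H₀
  set H : ℕ := max H₁ (natHeight P) with hHdef
  have hHP : natHeight P ≤ H := le_max_right _ _
  have hH0le : H₀ ≤ H := (le_max_left H₀ 2).trans (le_max_left _ _)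
  have hH2 : 2 ≤ H := hH₁2nat.trans (le_max_left _ _)
  have hH1r : (1 : ℝ) ≤ H := by exact_mod_cast le_trans (by norm_num) hH2
  have hHpos : (0 : ℝ) < H := by linarith
  set γ : Fin 2 ⊕ Fin 2 → ℂ := Sum.elim ![(1 : ℂ) + I, 1 - I] ![α, conj α] with hγ
  -- coordinatewise clauses at level (d, H)
  have hquad : ∀ z : ℂ, z = 1 + I ∨ z = 1 - I → ∃ Q : Polynomial ℤ, Q ≠ 0 ∧ Q.natDegree ≤ d ∧
      (∀ k, |Q.coeff k| ≤ (H : ℤ)) ∧ Polynomial.aeval z Q = 0 := by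
    intro z hz
    have hQ0 : (X ^ 2 - Polynomial.C 2 * X + Polynomial.C 2 : Polynomial ℤ) ≠ 0 := by
      intro h
      have := congrArg (fun Q : Polynomial ℤ => Q.coeff 0) h
      simp at this
    refine ⟨X ^ 2 - Polynomial.C 2 * X + Polynomial.C 2, hQ0, ?_, ?_, ?_⟩
    · have : (X ^ 2 - Polynomial.C 2 * X + Polynomial.C 2 : Polynomial ℤ).natDegree ≤ 2 := by
        compute_degree!
      exact this.trans h2d
    · intro k
      have hH2z : (2 : ℤ) ≤ H := by exact_mod_cast hH2
      exact (abs_coeff_quad_le k).trans hH2z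
    · have hI : I ^ 2 = -1 := Complex.I_sq
      rcases hz with rfl | rfl
      · rw [aeval_quad]; linear_combination hI
      · rw [aeval_quad]; linear_combination hI
  have hclα : ∀ z : ℂ, z = α ∨ z = conj α → ∃ Q : Polynomial ℤ, Q ≠ 0 ∧ Q.natDegree ≤ n ∧
      (∀ k, |Q.coeff k| ≤ (H : ℤ)) ∧ Polynomial.aeval z Q = 0 := by
    intro z hz
    refine ⟨P, hP0, hPdeg, fun k => (abs_coeff_le_natHeight P k).trans (by exact_mod_cast hHP), ?_⟩
    rcases hz with rfl | rfl
    · exact hPα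
    · exact hPα'
  have hcl : ∀ i, ∃ Q : Polynomial ℤ, Q ≠ 0 ∧ Q.natDegree ≤ d ∧ (∀ k, |Q.coeff k| ≤ (H : ℤ)) ∧
      Polynomial.aeval (γ i) Q = 0 := by
    rintro (i | i) <;> fin_cases i
    · exact hquad _ (Or.inl (by simp [hγ]))
    · exact hquad _ (Or.inr (by simp [hγ]))
    · obtain ⟨Q, h1, h2, h3, h4⟩ := hclα α (Or.inl rfl)
      exact ⟨Q, h1, h2.trans hnd, h3, by simpa [hγ] using h4⟩
    · obtain ⟨Q, h1, h2, h3, h4⟩ := hclα (conj α) (Or.inr rfl)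
      exact ⟨Q, h1, h2.trans hnd, h3, by simpa [hγ] using h4⟩
  -- the common field ℚ(i, α, conj α) has degree ≤ 2 n²
  have hfr : Module.finrank ℚ ↥(IntermediateField.adjoin ℚ (Set.range γ)) ≤ d := by
    have hIcl : ∃ Q : Polynomial ℤ, Q ≠ 0 ∧ Q.natDegree ≤ 2 ∧ (∀ k, |Q.coeff k| ≤ ((1 : ℕ) : ℤ)) ∧
        Polynomial.aeval I Q = 0 := by
      refine ⟨X ^ 2 + 1, ?_, by compute_degree!, ?_, by simp⟩
      · intro h
        have := congrArg (fun Q : Polynomial ℤ => Q.coeff 0) h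
        simp at this
      · intro k
        exact_mod_cast abs_coeff_Xsq_add_one_le k
    obtain ⟨hiI, hI⟩ := finrank_adjoin_simple_le_of_clause hIcl
    obtain ⟨hiα, hα⟩ := finrank_adjoin_simple_le_of_clause (hclα α (Or.inl rfl))
    obtain ⟨hiα', hα'⟩ := finrank_adjoin_simple_le_of_clause (hclα (conj α) (Or.inr rfl))
    haveI : FiniteDimensional ℚ ↥ℚ⟮I⟯ := IntermediateField.adjoin.finiteDimensional hiI
    haveI : FiniteDimensional ℚ ↥ℚ⟮α⟯ := IntermediateField.adjoin.finiteDimensional hiα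
    haveI : FiniteDimensional ℚ ↥ℚ⟮conj α⟯ := IntermediateField.adjoin.finiteDimensional hiα'
    set F : IntermediateField ℚ ℂ := ℚ⟮I⟯ ⊔ (ℚ⟮α⟯ ⊔ ℚ⟮conj α⟯) with hF
    have hIF : I ∈ F := (le_sup_left : ℚ⟮I⟯ ≤ F) (IntermediateField.mem_adjoin_simple_self ℚ _)
    have hαF : α ∈ F :=
      (le_sup_left.trans (le_sup_right : ℚ⟮α⟯ ⊔ ℚ⟮conj α⟯ ≤ F)) (IntermediateField.mem_adjoin_simple_self ℚ _)
    have hα'F : conj α ∈ F :=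
      (le_sup_right.trans (le_sup_right : ℚ⟮α⟯ ⊔ ℚ⟮conj α⟯ ≤ F)) (IntermediateField.mem_adjoin_simple_self ℚ _)
    have hle : IntermediateField.adjoin ℚ (Set.range γ) ≤ F := by
      rw [IntermediateField.adjoin_le_iff]
      rintro _ ⟨i, rfl⟩
      rcases i with i | i <;> fin_cases i
      · show (1 : ℂ) + I ∈ F
        exact add_mem (one_mem _) hIF
      · show (1 : ℂ) - I ∈ F
        exact sub_mem (one_mem _) hIF
      · exact hαF
      · exact hα'F
    calc Module.finrank ℚ ↥(IntermediateField.adjoin ℚ (Set.range γ))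
        ≤ Module.finrank ℚ ↥F := IntermediateField.finrank_le_of_le_right hle
      _ ≤ Module.finrank ℚ ↥ℚ⟮I⟯ * Module.finrank ℚ ↥(ℚ⟮α⟯ ⊔ ℚ⟮conj α⟯) :=
          IntermediateField.finrank_sup_le _ _
      _ ≤ Module.finrank ℚ ↥ℚ⟮I⟯ * (Module.finrank ℚ ↥ℚ⟮α⟯ * Module.finrank ℚ ↥ℚ⟮conj α⟯) :=
          Nat.mul_le_mul_left _ (IntermediateField.finrank_sup_le _ _)
      _ ≤ 2 * (n * n) := Nat.mul_le_mul hI (Nat.mul_le_mul hα hα')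
      _ = d := by rw [hddef]; ring
  have key := hH₀ H γ hH0le hfr hcl
  -- the distance is |ξ - α| in both transcendental slots
  have hdist' : ‖γ - Sum.elim ![(1 : ℂ) + I, 1 - I] (Complex.exp ∘ ![(1 : ℂ) + I, 1 - I])‖ ≤
      ‖ξ - α‖ := by
    refine (pi_norm_le_iff_of_nonneg (norm_nonneg _)).mpr ?_
    rintro (i | i) <;> revert i <;> refine Fin.forall_fin_two.mpr ⟨?_, ?_⟩
    · simp [hγ]
    · simp [hγ]
    · simp [hγ, hξ, norm_sub_rev]
    · calc ‖(γ - Sum.elim ![(1 : ℂ) + I, 1 - I] (Complex.exp ∘ ![(1 : ℂ) + I, 1 - I])) (Sum.inr 1)‖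
          = ‖conj α - conj ξ‖ := by simp [hγ, hξ, exp_one_sub_I]
        _ ≤ ‖ξ - α‖ := le_of_eq (by rw [← map_sub, Complex.norm_conj, norm_sub_rev])
  -- height bookkeeping: log H ≤ log H₁ + n log 2 + log M(P)
  have hlogH : Real.log H ≤ Real.log H₁ + n * Real.log 2 + Real.log MP := by
    have h2n1 : (1 : ℝ) ≤ 2 ^ n * MP := one_le_mul_of_one_le_of_one_le (one_le_pow₀ (by norm_num)) hMP1
    have hHle : (H : ℝ) ≤ (H₁ : ℝ) * (2 ^ n * MP) := by
      have hcast : (H : ℝ) = max (H₁ : ℝ) (natHeight P : ℝ) := by rw [hHdef]; push_cast; rfl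
      rw [hcast]
      refine max_le (le_mul_of_one_le_right hH₁pos.le h2n1) ?_
      calc (natHeight P : ℝ) ≤ 2 ^ P.natDegree * MP := natHeight_le P
        _ ≤ 2 ^ n * MP := by gcongr; norm_num
        _ ≤ (H₁ : ℝ) * (2 ^ n * MP) := le_mul_of_one_le_left (by positivity) hH₁1
    calc Real.log H ≤ Real.log ((H₁ : ℝ) * (2 ^ n * MP)) := Real.log_le_log hHpos hHle
      _ = Real.log H₁ + n * Real.log 2 + Real.log MP := by
        rw [Real.log_mul hH₁pos.ne' (by positivity), Real.log_mul (by positivity) (by positivity),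
          Real.log_pow]
        ring
  -- exponent bookkeeping
  have hna : (d : ℝ) ^ a ≤ (d : ℝ) ^ a' := Real.rpow_le_rpow_of_exponent_le hd1 (le_max_left _ _)
  have hnb : (d : ℝ) ^ b ≤ (d : ℝ) ^ b' := Real.rpow_le_rpow_of_exponent_le hd1 (le_max_left _ _)
  have hlogH0 : 0 ≤ Real.log H := Real.log_nonneg hH1r
  have hda'0 : 0 ≤ (d : ℝ) ^ a' := by positivity
  have hLHS : C * ((d : ℝ) ^ a * Real.log H + (d : ℝ) ^ b) ≤
      3 / 1000 * ((n : ℝ) * Real.log MP) + K0 := by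
    have step : C * (d : ℝ) ^ a' * Real.log MP ≤ 3 / 1000 * n * Real.log MP :=
      mul_le_mul_of_nonneg_right hda' hlogMP
    calc C * ((d : ℝ) ^ a * Real.log H + (d : ℝ) ^ b)
        ≤ C * ((d : ℝ) ^ a' * Real.log H + (d : ℝ) ^ b') := by gcongr
      _ ≤ C * ((d : ℝ) ^ a' * (Real.log H₁ + n * Real.log 2 + Real.log MP) + (d : ℝ) ^ b') := by
          gcongr
      _ = C * (d : ℝ) ^ a' * Real.log MP + K0 := by rw [hK0]; ring
      _ ≤ 3 / 1000 * n * Real.log MP + K0 := by linarith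
      _ = 3 / 1000 * ((n : ℝ) * Real.log MP) + K0 := by ring
  have hKM : K0 < 6 / 1000 * Real.log M := by
    have h6 : (6 / 1000 : ℝ) * (K0 / (6 / 1000)) = K0 := by field_simp
    have h := mul_le_mul_of_nonneg_left hlogM (by norm_num : (0 : ℝ) ≤ 6 / 1000)
    rw [mul_add, h6] at h
    linarith
  have hX0 : 0 ≤ (n : ℝ) * Real.log MP := by positivity
  have hlM : 0 ≤ Real.log M := by
    have hK0nn : 0 ≤ K0 := by rw [hK0]; positivity
    linarith
  have hY : Real.log M ≤ (P.natDegree : ℝ) * Real.log M :=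
    le_mul_of_one_le_left hlM (by exact_mod_cast hdP)
  have hgap : C * ((d : ℝ) ^ a * Real.log H + (d : ℝ) ^ b) <
      6 / 1000 * ((n : ℝ) * Real.log MP + (P.natDegree : ℝ) * Real.log M) := by
    linarith
  -- contradiction
  have hchain : Real.exp (-(C * ((d : ℝ) ^ a * Real.log H + (d : ℝ) ^ b))) ≤
      Real.exp (-(6 / 1000 * ((n : ℝ) * Real.log MP + (P.natDegree : ℝ) * Real.log M))) :=
    key.trans (hdist'.trans hdist)
  rw [Real.exp_le_exp] at hchain
  linarith

/-! ## Consequences: the sharp strengthening is false; the LW window cannot pass below `1/2` -/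

/-- The crux with the GENERIC exponent excluded: `a < 1/n` in place of `a < 1/(n−1)` (the route's
"expected truth `a = 1/n`" says this should fail; here it is kernel-checked at `n = 2`). -/
def KhovanskiiApproxTypeEvSharp : Prop :=
  ∀ (n : ℕ) (s : Fin n → ℂ), 2 ≤ n → LinearIndependent ℚ s →
    IsFreeKhovanskii n s → ∃ a b C : ℝ, a < 1 / (n : ℝ) ∧ ApproxTypeEvAt n s a b C

/-- The all-heights crux 6116 with the generic exponent excluded (`a < 1/n`). -/
def KhovanskiiApproxTypeSharp : Prop :=
  ∀ (n : ℕ) (s : Fin n → ℂ), 2 ≤ n → LinearIndependent ℚ s →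
    IsFreeKhovanskii n s → ∃ a b C : ℝ, a < 1 / (n : ℝ) ∧ ApproxTypeAt n s a b C

/-- **The eventual crux cannot be sharpened to `a < 1/n`:** at `n = 2`, `s = (1 + i, 1 − i)` no
eventual approximation type has `a < 1/2`. [folklore] -/
theorem khovanskiiApproxTypeEv_false_sharp : ¬ KhovanskiiApproxTypeEvSharp := by
  intro h
  obtain ⟨a, b, C, ha, hAT⟩ := h 2 _ le_rfl linearIndependent_conjPair isFreeKhovanskii_conjPair
  have ha' : a < 1 / 2 := by norm_num at ha ⊢; linarith
  exact not_approxTypeEvAt_conjPair a b C ha' hAT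

/-- **Nor can the all-heights crux 6116** (it implies its eventual form pointwise). [folklore] -/
theorem khovanskiiApproxType_false_sharp : ¬ KhovanskiiApproxTypeSharp := by
  intro h
  obtain ⟨a, b, C, ha, hC, hAT⟩ := h 2 _ le_rfl linearIndependent_conjPair isFreeKhovanskii_conjPair
  have ha' : a < 1 / 2 := by norm_num at ha ⊢; linarith
  exact not_approxTypeEvAt_conjPair a b C ha'
    ⟨hC, fun d => ⟨0, fun H γ _ hdeg hroot => hAT d H γ hdeg hroot⟩⟩

/-- **The window of the Lindemann–Weierstrass layer is `[1/2, 1)`:** whatever exponent `EvLWTwo`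
is proved with (the line's value is `3/4`), at the LW point `(1 + i, 1 − i)` every admissible
exponent is `≥ 1/2`. [folklore] -/
theorem evLWTwo_exponent_ge_half (a b C : ℝ) (h : ApproxTypeEvAt 2 ![(1 : ℂ) + I, 1 - I] a b C) :
    1 / 2 ≤ a := by
  by_contra hlt
  exact not_approxTypeEvAt_conjPair a b C (not_le.mp hlt) h

/-- The LW point `(1 + i, 1 − i)` is in the scope of `EvLWTwo` (both coordinates algebraic), so the
layer statement itself pins its exponent there into `[1/2, 1)`. [folklore] -/
theorem evLWTwo_window (hLW : EvLWTwo) :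
    ∃ a b C : ℝ, 1 / 2 ≤ a ∧ a < 1 ∧ ApproxTypeEvAt 2 ![(1 : ℂ) + I, 1 - I] a b C := by
  have halg : ∀ i, IsAlgebraic ℚ (![(1 : ℂ) + I, 1 - I] i) := by
    have hI : IsAlgebraic ℚ I := ⟨X ^ 2 + 1, by
      intro h; have := congrArg (fun Q : Polynomial ℚ => Q.coeff 0) h; simp at this, by simp⟩
    have h1 : IsAlgebraic ℚ (1 : ℂ) := isAlgebraic_one
    intro i
    fin_cases i
    · exact h1.add hI
    · exact h1.sub hI
  obtain ⟨a, b, C, ha, hAT⟩ := hLW _ halg linearIndependent_conjPair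
  exact ⟨a, b, C, evLWTwo_exponent_ge_half a b C hAT, ha, hAT⟩

/-! # (c') The floor `a ≥ 1/2` at `n = 2`, log point (copy of the proposed `Negative/ConjugateFloorLog.lean`) -/

section LogPoint
open Literature.NumberTheory.Transcendental (transcendental_exp_holds)

/-! ## The point `s = (λ, λ̄)`, `λ = log(2i)` -/

/-- `λ = log(2i)` (principal value `log 2 + iπ/2`). -/
def lam : ℂ := Complex.log (2 * I)

theorem two_I_ne_zero : (2 : ℂ) * I ≠ 0 := mul_ne_zero two_ne_zero I_ne_zero

theorem exp_lam : Complex.exp lam = 2 * I := Complex.exp_log two_I_ne_zero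

theorem conj_two : conj (2 : ℂ) = 2 := by
  apply Complex.ext <;> simp

theorem conj_two_I : conj ((2 : ℂ) * I) = -(2 * I) := by
  apply Complex.ext <;> simp

/-- Simp-normal form: `simp` rewrites `cexp (conj λ)` to `conj (cexp λ)` first (`Complex.exp_conj`). -/
theorem conj_exp_lam : conj (Complex.exp lam) = -(2 * I) := by
  rw [exp_lam, conj_two_I]

theorem exp_conj_lam : Complex.exp (conj lam) = -(2 * I) := by
  rw [Complex.exp_conj, conj_exp_lam]

theorem lam_re : lam.re = Real.log 2 := by
  rw [lam, Complex.log_re]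
  congr 1
  simp

theorem lam_re_ne : lam.re ≠ 0 := by
  rw [lam_re]; exact (Real.log_pos one_lt_two).ne'

theorem lam_im_ne : lam.im ≠ 0 := by
  rw [lam, Complex.log_im]
  intro h
  rw [Complex.arg_eq_zero_iff] at h
  simp at h

theorem lam_ne : lam ≠ 0 := fun h => lam_re_ne (by rw [h, Complex.zero_re])

/-- `(λ, λ̄)` is `ℚ`-linearly independent (`Re λ ≠ 0`, `Im λ ≠ 0`). -/
theorem linearIndependent_conjLogPair : LinearIndependent ℚ ![lam, conj lam] := by
  rw [LinearIndependent.pair_iff]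
  intro s t hst
  rw [Rat.smul_def, Rat.smul_def] at hst
  have hre := congrArg Complex.re hst
  have him := congrArg Complex.im hst
  simp only [Complex.add_re, Complex.mul_re, Complex.ratCast_re, Complex.ratCast_im, zero_mul,
    sub_zero, Complex.conj_re, Complex.zero_re, Complex.add_im, Complex.mul_im, Complex.conj_im,
    add_zero, Complex.zero_im] at hre him
  have h1 : ((s : ℝ) + t) * lam.re = 0 := by linarith
  have h2 : ((s : ℝ) - t) * lam.im = 0 := by linarith
  have h1' := (mul_eq_zero.mp h1).resolve_right lam_re_ne
  have h2' := (mul_eq_zero.mp h2).resolve_right lam_im_ne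
  have hs : (s : ℝ) = 0 := by linarith
  have ht : (t : ℝ) = 0 := by linarith
  exact ⟨by exact_mod_cast hs, by exact_mod_cast ht⟩

/-- `λ = log(2i)` is transcendental (Hermite–Lindemann: `e^{λ} = 2i` is algebraic, `λ ≠ 0`). -/
theorem transcendental_lam : Transcendental ℚ lam := by
  intro halg
  have h2I : IsAlgebraic ℚ ((2 : ℂ) * I) := by
    have hI : IsAlgebraic ℚ I := ⟨X ^ 2 + 1, by
      intro h; have := congrArg (fun Q : Polynomial ℚ => Q.coeff 0) h; simp at this, by simp⟩
    exact (isAlgebraic_nat 2).mul hI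
  have ht := transcendental_exp_holds halg lam_ne
  rw [exp_lam] at ht
  exact ht h2I

/-- `(λ, λ̄)` is a non-degenerate zero of the Khovanskii system `y₁ + y₂ = 0`, `y₁ y₂ − 4 = 0` over
`ℚ` (`e^{λ} = 2i`, `e^{λ̄} = −2i`): exponential Jacobian `[[y₁, y₂], [y₁ y₂, y₁ y₂]]`, determinant
`y₁ y₂ (y₁ − y₂) = 16 i ≠ 0`. -/
theorem isFreeKhovanskii_conjLogPair : IsFreeKhovanskii 2 ![lam, conj lam] := by
  classical
  refine ⟨![MvPolynomial.X (Sum.inr 0) + MvPolynomial.X (Sum.inr 1),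
    MvPolynomial.X (Sum.inr 0) * MvPolynomial.X (Sum.inr 1) - MvPolynomial.C 4], ?_, ?_⟩
  · intro i
    fin_cases i
    · simp [exp_lam, conj_two]
    · simp [exp_lam, conj_two]
      ring_nf
      simp
  · rw [Matrix.det_fin_two]
    simp [Matrix.of_apply, MvPolynomial.pderiv_X, Derivation.leibniz, exp_lam, conj_two]
    ring_nf
    simp [Complex.ext_iff]

/-- Evaluation of `Y² + 4` (minimal polynomial of `±2i`). -/
theorem aeval_sq_add_four (z : ℂ) :
    Polynomial.aeval z (X ^ 2 + Polynomial.C 4 : Polynomial ℤ) = z ^ 2 + 4 := by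
  simp only [map_add, map_pow, Polynomial.aeval_X, map_ofNat]

/-- The coefficients of `Y² + 4` are bounded by `4` in absolute value. -/
theorem abs_coeff_sq_add_four_le (k : ℕ) :
    |(X ^ 2 + Polynomial.C 4 : Polynomial ℤ).coeff k| ≤ 4 := by
  rcases k with _ | _ | _ | k
  · norm_num [coeff_C, coeff_X_pow]
  · norm_num [coeff_C, coeff_X_pow]
  · norm_num [coeff_C, coeff_X_pow]
  · have hk : k + 1 + 1 + 1 ≠ 2 := by omega
    simp [coeff_X_pow, hk]

/-! ## The engine at the log point -/

set_option maxHeartbeats 1600000 in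
/-- **At `θ = (λ, λ̄, 2i, −2i)`, `λ = log(2i)`, there is no eventual approximation type with
`a < 1/2`.**  Challengers `(α, ᾱ, 2i, −2i)`, `α` the Diaz approximation of `λ` of degree `≤ n`
(Bugeaud 2004 Thm 8.11, PROVED in tree), budget `d = 2n²` (field `ℚ(i, α, ᾱ)`), height
`H = max(H₀(d), 4, H(minpoly α))`; `|λ̄ − ᾱ| = |λ − α|`; quality `0.006(n log M(α) + deg α · log M)`
linear in `n ≍ d^{1/2}`. [cite: Bugeaud2004, Thm 8.11] -/
theorem not_approxTypeEvAt_conjLogPair (a b C : ℝ) (ha : a < 1 / 2) :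
    ¬ ApproxTypeEvAt 2 ![lam, conj lam] a b C := by
  rintro ⟨hC, hall⟩
  -- nonnegative exponents dominate
  set a' : ℝ := max a 0 with ha'
  set b' : ℝ := max b 0 with hb'
  have ha'h : a' < 1 / 2 := max_lt ha (by norm_num)
  have ha'0 : 0 ≤ a' := le_max_right _ _
  have h2a' : 2 * a' < 1 := by linarith
  obtain ⟨n, hn50, hn⟩ := exists_deg (2 * a') (2 * C) h2a' (by linarith)
  have hn1nat : 1 ≤ n := le_trans (by norm_num) hn50
  have hn1 : (1 : ℝ) ≤ n := by exact_mod_cast hn1nat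
  have hnpos : (0 : ℝ) < n := by linarith
  -- the budget d = 2 n² and the bound C d^{a'} ≤ 0.003 n
  set d : ℕ := 2 * n ^ 2 with hddef
  have hdcast : (d : ℝ) = 2 * (n : ℝ) ^ 2 := by rw [hddef]; push_cast; ring
  have hnd : n ≤ d := by rw [hddef]; nlinarith
  have h2d : 2 ≤ d := by rw [hddef]; nlinarith
  have hd1 : (1 : ℝ) ≤ d := by exact_mod_cast (hn1nat.trans hnd)
  have hdpos : (0 : ℝ) < d := by linarith
  have hda' : C * (d : ℝ) ^ a' ≤ 3 / 1000 * n := by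
    have h1 : (d : ℝ) ^ a' = (2 : ℝ) ^ a' * (n : ℝ) ^ (2 * a') := by
      rw [hdcast, Real.mul_rpow (by norm_num) (by positivity)]
      congr 1
      rw [show ((n : ℝ) ^ 2) = (n : ℝ) ^ (2 : ℝ) by norm_cast, ← Real.rpow_mul hnpos.le]
    have h2 : (2 : ℝ) ^ a' ≤ 2 := by
      have := Real.rpow_le_rpow_of_exponent_le (by norm_num : (1 : ℝ) ≤ 2) (by linarith : a' ≤ 1)
      rwa [Real.rpow_one] at this
    have h3 : 0 ≤ (n : ℝ) ^ (2 * a') := by positivity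
    calc C * (d : ℝ) ^ a' = C * ((2 : ℝ) ^ a' * (n : ℝ) ^ (2 * a')) := by rw [h1]
      _ ≤ C * (2 * (n : ℝ) ^ (2 * a')) := by gcongr
      _ = 2 * C * (n : ℝ) ^ (2 * a') := by ring
      _ ≤ 3 / 1000 * n := hn
  -- the threshold of the eventual form at budget d
  obtain ⟨H₀, hH₀⟩ := hall d
  set H₁ : ℕ := max H₀ 4 with hH₁def
  have hH₁4nat : 4 ≤ H₁ := le_max_right _ _
  have hH₁1nat : 1 ≤ H₁ := le_trans (by norm_num) hH₁4nat
  have hH₁1 : (1 : ℝ) ≤ H₁ := by exact_mod_cast hH₁1nat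
  have hH₁pos : (0 : ℝ) < H₁ := by linarith
  have hlogH₁ : 0 ≤ Real.log H₁ := Real.log_nonneg hH₁1
  -- the M-independent slack (threshold included) and the choice of M
  set K0 : ℝ := C * ((d : ℝ) ^ a' * (n * Real.log 2 + Real.log H₁) + (d : ℝ) ^ b') with hK0
  set ξ : ℂ := lam with hξ
  set M : ℝ := max (max ((n : ℝ) + 1) ((4 + ‖ξ‖) ^ 100)) (Real.exp (K0 / (6 / 1000) + 1))
    with hMdef
  have hM1 : (n : ℝ) + 1 ≤ M := (le_max_left _ _).trans (le_max_left _ _)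
  have hM2 : (4 + ‖ξ‖) ^ 100 ≤ M := (le_max_right _ _).trans (le_max_left _ _)
  have hMpos : 0 < M := by linarith
  have hlogM : K0 / (6 / 1000) + 1 ≤ Real.log M := by
    rw [Real.le_log_iff_exp_le hMpos]
    exact le_max_right _ _
  -- Diaz / Bugeaud 8.11 at ξ = λ
  obtain ⟨α, P, hPirr, hPα, hPdeg, hPM, hdist⟩ := Bugeaud2004_thm_8_11_holds ξ n M hn50 hM1 hM2
  have hP0 : P ≠ 0 := hPirr.ne_zero
  have hdP : 1 ≤ P.natDegree := by
    rw [Nat.one_le_iff_ne_zero]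
    intro h0
    have hc : P = Polynomial.C (P.coeff 0) := eq_C_of_natDegree_eq_zero h0
    rw [hc, aeval_C, algebraMap_int_eq, eq_intCast, Int.cast_eq_zero] at hPα
    exact hP0 (by rw [hc, hPα, map_zero])
  set MP : ℝ := (P.map (Int.castRingHom ℂ)).mahlerMeasure with hMP
  have hMP1 : 1 ≤ MP := one_le_mahlerMeasure_map P hP0
  have hlogMP : 0 ≤ Real.log MP := Real.log_nonneg hMP1
  -- the conjugate root
  have hPα' : Polynomial.aeval (conj α) P = 0 := by
    have h := Polynomial.aeval_algHom_apply ((starRingEnd ℂ).toIntAlgHom) α P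
    rw [RingHom.toIntAlgHom_apply] at h
    change Polynomial.aeval (conj α) P = conj (Polynomial.aeval α P) at h
    rw [h, hPα, map_zero]
  -- the challenger γ = (α, conj α, 2i, −2i), budget d, height H := max H₁ (natHeight P) ≥ H₀
  set H : ℕ := max H₁ (natHeight P) with hHdef
  have hHP : natHeight P ≤ H := le_max_right _ _
  have hH0le : H₀ ≤ H := (le_max_left H₀ 4).trans (le_max_left _ _)
  have hH4 : 4 ≤ H := hH₁4nat.trans (le_max_left _ _)
  have hH1 : 1 ≤ H := le_trans (by norm_num) hH4
  have hH1r : (1 : ℝ) ≤ H := by exact_mod_cast hH1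
  have hHpos : (0 : ℝ) < H := by linarith
  set γ : Fin 2 ⊕ Fin 2 → ℂ := Sum.elim ![α, conj α] ![(2 : ℂ) * I, -(2 * I)] with hγ
  -- coordinatewise clauses at level (d, H)
  have hquad : ∀ z : ℂ, z = 2 * I ∨ z = -(2 * I) → ∃ Q : Polynomial ℤ, Q ≠ 0 ∧ Q.natDegree ≤ d ∧
      (∀ k, |Q.coeff k| ≤ (H : ℤ)) ∧ Polynomial.aeval z Q = 0 := by
    intro z hz
    have hQ0 : (X ^ 2 + Polynomial.C 4 : Polynomial ℤ) ≠ 0 := by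
      intro h
      have := congrArg (fun Q : Polynomial ℤ => Q.coeff 0) h
      simp at this
    refine ⟨X ^ 2 + Polynomial.C 4, hQ0, ?_, ?_, ?_⟩
    · have : (X ^ 2 + Polynomial.C 4 : Polynomial ℤ).natDegree ≤ 2 := by compute_degree!
      exact this.trans h2d
    · intro k
      have hH4z : (4 : ℤ) ≤ H := by exact_mod_cast hH4
      exact (abs_coeff_sq_add_four_le k).trans hH4z
    · have hI : I ^ 2 = -1 := Complex.I_sq
      rcases hz with rfl | rfl
      · rw [aeval_sq_add_four]; linear_combination (4 : ℂ) * hI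
      · rw [aeval_sq_add_four]; linear_combination (4 : ℂ) * hI
  have hclα : ∀ z : ℂ, z = α ∨ z = conj α → ∃ Q : Polynomial ℤ, Q ≠ 0 ∧ Q.natDegree ≤ n ∧
      (∀ k, |Q.coeff k| ≤ (H : ℤ)) ∧ Polynomial.aeval z Q = 0 := by
    intro z hz
    refine ⟨P, hP0, hPdeg, fun k => (abs_coeff_le_natHeight P k).trans (by exact_mod_cast hHP), ?_⟩
    rcases hz with rfl | rfl
    · exact hPα
    · exact hPα'
  have hcl : ∀ i, ∃ Q : Polynomial ℤ, Q ≠ 0 ∧ Q.natDegree ≤ d ∧ (∀ k, |Q.coeff k| ≤ (H : ℤ)) ∧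
      Polynomial.aeval (γ i) Q = 0 := by
    rintro (i | i) <;> fin_cases i
    · obtain ⟨Q, h1, h2, h3, h4⟩ := hclα α (Or.inl rfl)
      exact ⟨Q, h1, h2.trans hnd, h3, by simpa [hγ] using h4⟩
    · obtain ⟨Q, h1, h2, h3, h4⟩ := hclα (conj α) (Or.inr rfl)
      exact ⟨Q, h1, h2.trans hnd, h3, by simpa [hγ] using h4⟩
    · exact hquad _ (Or.inl (by simp [hγ]))
    · exact hquad _ (Or.inr (by simp [hγ]))
  -- the common field ℚ(i, α, conj α) has degree ≤ 2 n²
  have hfr : Module.finrank ℚ ↥(IntermediateField.adjoin ℚ (Set.range γ)) ≤ d := by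
    have hIcl : ∃ Q : Polynomial ℤ, Q ≠ 0 ∧ Q.natDegree ≤ 2 ∧ (∀ k, |Q.coeff k| ≤ ((1 : ℕ) : ℤ)) ∧
        Polynomial.aeval I Q = 0 := by
      refine ⟨X ^ 2 + 1, ?_, by compute_degree!, ?_, by simp⟩
      · intro h
        have := congrArg (fun Q : Polynomial ℤ => Q.coeff 0) h
        simp at this
      · intro k
        exact_mod_cast abs_coeff_Xsq_add_one_le k
    obtain ⟨hiI, hI⟩ := finrank_adjoin_simple_le_of_clause hIcl
    obtain ⟨hiα, hα⟩ := finrank_adjoin_simple_le_of_clause (hclα α (Or.inl rfl))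
    obtain ⟨hiα', hα'⟩ := finrank_adjoin_simple_le_of_clause (hclα (conj α) (Or.inr rfl))
    haveI : FiniteDimensional ℚ ↥ℚ⟮I⟯ := IntermediateField.adjoin.finiteDimensional hiI
    haveI : FiniteDimensional ℚ ↥ℚ⟮α⟯ := IntermediateField.adjoin.finiteDimensional hiα
    haveI : FiniteDimensional ℚ ↥ℚ⟮conj α⟯ := IntermediateField.adjoin.finiteDimensional hiα'
    set F : IntermediateField ℚ ℂ := ℚ⟮I⟯ ⊔ (ℚ⟮α⟯ ⊔ ℚ⟮conj α⟯) with hF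
    have hIF : I ∈ F := (le_sup_left : ℚ⟮I⟯ ≤ F) (IntermediateField.mem_adjoin_simple_self ℚ _)
    have h2IF : (2 : ℂ) * I ∈ F := mul_mem (by exact_mod_cast natCast_mem F 2) hIF
    have hαF : α ∈ F :=
      (le_sup_left.trans (le_sup_right : ℚ⟮α⟯ ⊔ ℚ⟮conj α⟯ ≤ F)) (IntermediateField.mem_adjoin_simple_self ℚ _)
    have hα'F : conj α ∈ F :=
      (le_sup_right.trans (le_sup_right : ℚ⟮α⟯ ⊔ ℚ⟮conj α⟯ ≤ F)) (IntermediateField.mem_adjoin_simple_self ℚ _)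
    have hle : IntermediateField.adjoin ℚ (Set.range γ) ≤ F := by
      rw [IntermediateField.adjoin_le_iff]
      rintro _ ⟨i, rfl⟩
      rcases i with i | i <;> fin_cases i
      · exact hαF
      · exact hα'F
      · show (2 : ℂ) * I ∈ F
        exact h2IF
      · show -((2 : ℂ) * I) ∈ F
        exact neg_mem h2IF
    calc Module.finrank ℚ ↥(IntermediateField.adjoin ℚ (Set.range γ))
        ≤ Module.finrank ℚ ↥F := IntermediateField.finrank_le_of_le_right hle
      _ ≤ Module.finrank ℚ ↥ℚ⟮I⟯ * Module.finrank ℚ ↥(ℚ⟮α⟯ ⊔ ℚ⟮conj α⟯) :=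
          IntermediateField.finrank_sup_le _ _
      _ ≤ Module.finrank ℚ ↥ℚ⟮I⟯ * (Module.finrank ℚ ↥ℚ⟮α⟯ * Module.finrank ℚ ↥ℚ⟮conj α⟯) :=
          Nat.mul_le_mul_left _ (IntermediateField.finrank_sup_le _ _)
      _ ≤ 2 * (n * n) := Nat.mul_le_mul hI (Nat.mul_le_mul hα hα')
      _ = d := by rw [hddef]; ring
  have key := hH₀ H γ hH0le hfr hcl
  -- the distance is |λ - α| in both transcendental slots, 0 in the algebraic ones
  have hdist' : ‖γ - Sum.elim ![lam, conj lam] (Complex.exp ∘ ![lam, conj lam])‖ ≤ ‖ξ - α‖ := by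
    refine (pi_norm_le_iff_of_nonneg (norm_nonneg _)).mpr ?_
    rintro (i | i) <;> revert i <;> refine Fin.forall_fin_two.mpr ⟨?_, ?_⟩
    · simp [hγ, hξ, norm_sub_rev]
    · calc ‖(γ - Sum.elim ![lam, conj lam] (Complex.exp ∘ ![lam, conj lam])) (Sum.inl 1)‖
          = ‖conj α - conj ξ‖ := by simp [hγ, hξ]
        _ ≤ ‖ξ - α‖ := le_of_eq (by rw [← map_sub, Complex.norm_conj, norm_sub_rev])
    · simp [hγ, exp_lam]
    · simp [hγ, conj_exp_lam]
  -- height bookkeeping: log H ≤ log H₁ + n log 2 + log M(P)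
  have hlogH : Real.log H ≤ Real.log H₁ + n * Real.log 2 + Real.log MP := by
    have h2n1 : (1 : ℝ) ≤ 2 ^ n * MP := one_le_mul_of_one_le_of_one_le (one_le_pow₀ (by norm_num)) hMP1
    have hHle : (H : ℝ) ≤ (H₁ : ℝ) * (2 ^ n * MP) := by
      have hcast : (H : ℝ) = max (H₁ : ℝ) (natHeight P : ℝ) := by rw [hHdef]; push_cast; rfl
      rw [hcast]
      refine max_le (le_mul_of_one_le_right hH₁pos.le h2n1) ?_
      calc (natHeight P : ℝ) ≤ 2 ^ P.natDegree * MP := natHeight_le P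
        _ ≤ 2 ^ n * MP := by gcongr; norm_num
        _ ≤ (H₁ : ℝ) * (2 ^ n * MP) := le_mul_of_one_le_left (by positivity) hH₁1
    calc Real.log H ≤ Real.log ((H₁ : ℝ) * (2 ^ n * MP)) := Real.log_le_log hHpos hHle
      _ = Real.log H₁ + n * Real.log 2 + Real.log MP := by
        rw [Real.log_mul hH₁pos.ne' (by positivity), Real.log_mul (by positivity) (by positivity),
          Real.log_pow]
        ring
  -- exponent bookkeeping
  have hna : (d : ℝ) ^ a ≤ (d : ℝ) ^ a' := Real.rpow_le_rpow_of_exponent_le hd1 (le_max_left _ _)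
  have hnb : (d : ℝ) ^ b ≤ (d : ℝ) ^ b' := Real.rpow_le_rpow_of_exponent_le hd1 (le_max_left _ _)
  have hlogH0 : 0 ≤ Real.log H := Real.log_nonneg hH1r
  have hda'0 : 0 ≤ (d : ℝ) ^ a' := by positivity
  have hLHS : C * ((d : ℝ) ^ a * Real.log H + (d : ℝ) ^ b) ≤
      3 / 1000 * ((n : ℝ) * Real.log MP) + K0 := by
    have step : C * (d : ℝ) ^ a' * Real.log MP ≤ 3 / 1000 * n * Real.log MP :=
      mul_le_mul_of_nonneg_right hda' hlogMP
    calc C * ((d : ℝ) ^ a * Real.log H + (d : ℝ) ^ b)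
        ≤ C * ((d : ℝ) ^ a' * Real.log H + (d : ℝ) ^ b') := by gcongr
      _ ≤ C * ((d : ℝ) ^ a' * (Real.log H₁ + n * Real.log 2 + Real.log MP) + (d : ℝ) ^ b') := by
          gcongr
      _ = C * (d : ℝ) ^ a' * Real.log MP + K0 := by rw [hK0]; ring
      _ ≤ 3 / 1000 * n * Real.log MP + K0 := by linarith
      _ = 3 / 1000 * ((n : ℝ) * Real.log MP) + K0 := by ring
  have hKM : K0 < 6 / 1000 * Real.log M := by
    have h6 : (6 / 1000 : ℝ) * (K0 / (6 / 1000)) = K0 := by field_simp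
    have h := mul_le_mul_of_nonneg_left hlogM (by norm_num : (0 : ℝ) ≤ 6 / 1000)
    rw [mul_add, h6] at h
    linarith
  have hX0 : 0 ≤ (n : ℝ) * Real.log MP := by positivity
  have hlM : 0 ≤ Real.log M := by
    have hK0nn : 0 ≤ K0 := by rw [hK0]; positivity
    linarith
  have hY : Real.log M ≤ (P.natDegree : ℝ) * Real.log M :=
    le_mul_of_one_le_left hlM (by exact_mod_cast hdP)
  have hgap : C * ((d : ℝ) ^ a * Real.log H + (d : ℝ) ^ b) <
      6 / 1000 * ((n : ℝ) * Real.log MP + (P.natDegree : ℝ) * Real.log M) := by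
    linarith
  -- contradiction
  have hchain : Real.exp (-(C * ((d : ℝ) ^ a * Real.log H + (d : ℝ) ^ b))) ≤
      Real.exp (-(6 / 1000 * ((n : ℝ) * Real.log MP + (P.natDegree : ℝ) * Real.log M))) :=
    key.trans (hdist'.trans hdist)
  rw [Real.exp_le_exp] at hchain
  linarith

/-- **The non-LW layer's window is `[1/2, 1)` too:** IF `EvNonLWTwo` holds, its exponent at the log
point `(λ, λ̄)` (in scope: `λ` transcendental, `s` free Khovanskii and lin. independent) is `≥ 1/2`.
[folklore] -/
theorem evNonLWTwo_window (hN : EvNonLWTwo) :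
    ∃ a b C : ℝ, 1 / 2 ≤ a ∧ a < 1 ∧ ApproxTypeEvAt 2 ![lam, conj lam] a b C := by
  obtain ⟨a, b, C, ha, hAT⟩ := hN _ linearIndependent_conjLogPair isFreeKhovanskii_conjLogPair
    ⟨0, by simpa using transcendental_lam⟩
  refine ⟨a, b, C, ?_, ha, hAT⟩
  by_contra hlt
  exact not_approxTypeEvAt_conjLogPair a b C (not_le.mp hlt) hAT

end LogPoint

/-! # (e) Near-misses (sorried; obstruction in the docstring) -/

/-- The eventual crux with the Khovanskii (non-degeneracy) hypothesis DROPPED, linear independence kept. -/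
def KhovanskiiApproxTypeEvWithoutKhovanskii : Prop :=
  ∀ (n : ℕ) (s : Fin n → ℂ), 2 ≤ n → LinearIndependent ℚ s →
    ∃ a b C : ℝ, a < 1 / ((n : ℝ) - 1) ∧ ApproxTypeEvAt n s a b C

/-- NEAR-MISS (open): **is non-degeneracy load-bearing for the EVENTUAL crux?**  The 6116 witness
(ultra-Liouville tower `s = (log 2, r log 2)`, `Negative/WithoutKhovanskiiStage.lean`) lives in height
WINDOWS and is outrun by a point-dependent threshold `H₀(d)` (module docstring §(a)).  A witness here must
be a `ℚ`-linearly independent `s ∈ ℂ²` with `θ = (s, e^s)` admitting, at ONE fixed degree `d`,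
infinitely many challengers of quality `H^{−C dᵃ}` for the given `(a, C)` — and this for every
`a < 1`, `C`.  Tried: (1) one transcendental direction (`θ ⊂ ℚ(τ)^{alg}`): forces `trdeg θ = 1`, a
Schanuel counterexample for lin. independent `s` — unavailable; (2) `s = (1, ξ)`, `ξ` constructed as a
fast limit: the slots `e` and `e^ξ` (or `ξ`) need two Diaz approximants in one field of degree `n²`
with un-synchronisable heights — reaches only `a < 1/2`; (3) `s = (1, log ζ)`, `ζ` Liouville: `e^{s₂} = ζ`
is bounded-degree Liouville but `log ζ ≈ log(p/q)` needs algebraic approximations of `log(p/q)`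
synchronised with those of `e` — same wall; (4) Baire category over `s`: reduces to an unproved
existence theorem for algebraic points of bounded degree `d` within `H^{−ω}`, `ω ≍ d`, of the graph of
`exp` (pairs `(β, β')` with `|e^β − β'| < H^{−ω}`; Baker-type lower bounds allow it, counting heuristics
predict `ω ≈ d + 3`, nothing proved).  So: OPEN; no evidence either way. -/
theorem khovanskiiApproxTypeEv_false_without_khovanskii :
    ¬ KhovanskiiApproxTypeEvWithoutKhovanskii := by
  sorry

/-- NEAR-MISS (open here): the floor `a ≥ 1/3` at the Lindemann–Weierstrass point `(1, √2, √3)` of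
`ℂ³` (generic exponent `1/n`).  Printed route: AP(3) at `θ` (Philippon; t = 3 modulo an interpolation
clause).  Diaz route: three approximants `αᵢ ≈ e^{sᵢ}` of degree `m` in a field of degree `≤ 4m³`
would give it IF their heights could be synchronised (`|e^{sᵢ} − αᵢ| ≤ H^{−cm}` with a COMMON `H`);
Bugeaud 8.11 bounds `M(αᵢ) ≤ M` only from above.  A synchronised simultaneous version (Bugeaud 2003,
J. Théor. Nombres Bordeaux 15, for pairs with an S-number) is not in tree (cf. hypothesis `hB` of
`Theorems/EPiSimultaneousTypeEv/Negative/CoordinatewiseLinear.lean`). -/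
theorem floor_third_at_lw_three (a b C : ℝ) (ha : a < 1 / 3) :
    ¬ ApproxTypeEvAt 3 ![(1 : ℂ), ((Real.sqrt 2 : ℝ) : ℂ), ((Real.sqrt 3 : ℝ) : ℂ)] a b C := by
  sorry

end Summit.Schanuel.Schanuel.Cruxes.KhovanskiiApproxTypeEv.Disproof

end
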